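import Literature.Computability.Complexity.SymmetricThresholdProgramsMinCell
import Literature.Computability.Complexity.SymmetricThresholdProgramsRefineIter
import Summits.PneNP.PneNP.Theorems.SymmetryBudgetNoHiddenOrderReplayAtomDefs
import Summits.PneNP.PneNP.Theorems.SymmetryBudgetNoHiddenOrderPerPathReplay

/-!
# `NoHiddenOrder` (stmt-PneNP-14781), (R2c) replay circuit II: the REPLAY module — definitions

Route `PneNP/SymmetryBudget`.  The label-driven replay of the per-path canoniser (`BranchSum.replay`,
`…PerPathReplay.lean`): at a state `(A, col)` with at least two vertices, look at the label points
`S ∩ smallestCell A col`; if one of them has strictly the largest height, take the OR-step there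
(`orStep`: refine the individualised colouring inside `A`, pass to the atom of the pointer), else stop.
This file is the DATA of a symmetric threshold program doing `F` such steps: `ReplayIter P V N T J F` holds

* the static label data: pointer `ptr`, label points `S`, heights `hgt`; the shared adjacency wires;
* STATE WIRES `memS k`, `ltS k`, `eqS k` (`k ≤ F`): block membership and order/kernel of the colouring —
  stage `0` is read from outside (the root state), stage `k + 1` is the multiplexer of stage `k` and the
  OR-step of stage `k` by the "step taken" gate `go k`;
* per stage `k < F`: a `MinCell` gadget (first smallest cell), the choice gates (`insel`, `dom`: the unique
  dominating label point, `go`), the order/kernel gates of the individualised colouring (`ltI`, `eqI`), a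
  `RefineIter` module (`T` rounds of ordered refinement inside the block), an `AtomIter` module (`J` rounds
  towards the atom of the pointer under the refined kernel), and the multiplexer gates;
all tied by consistency equations.  Semantics in `SymmetryBudgetNoHiddenOrderReplayIter.lean`.
Definitions only; supports stmt-PneNP-14781.
-/

set_option linter.dupNamespace false -- `Summit.PneNP.PneNP.…` (D-0017 single-conjunct layout)

namespace Summit.PneNP.PneNP.Theorems

open Finset Literature.Computability.Complexity Literature.Computability.Complexity.SymProg

variable {ι Λ : Type*} [DecidableEq ι] [DecidableEq Λ] (P : SymProg ι Λ)
variable (V : Type*) [Fintype V] [DecidableEq V] (N T J F : ℕ)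

/-- **The replay module** (see the module docstring). [folklore] -/
structure ReplayIter where
  /-- adjacency wires (shared by everything) -/
  adj : V → V → ι ⊕ Λ
  /-- the pointer of the label -/
  ptr : V
  /-- the label points -/
  S : Finset V
  /-- the heights of the label points -/
  hgt : V → ℕ
  /-- STATE: block membership entering stage `k` -/
  memS : Fin (F + 1) → V → ι ⊕ Λ
  /-- STATE: order of the colouring entering stage `k` -/
  ltS : Fin (F + 1) → V → V → ι ⊕ Λ
  /-- STATE: kernel of the colouring entering stage `k` -/
  eqS : Fin (F + 1) → V → V → ι ⊕ Λ
  /-- stage `k`: the first-smallest-cell gadget on the state -/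
  M : Fin F → P.MinCell V N
  /-- `insel k t = memS k t ∧ sel t`: `t` is in the block and in the first smallest cell -/
  insel : Fin F → V → Λ
  /-- `nins k t = ¬ insel k t` -/
  nins : Fin F → V → Λ
  /-- `dom k t`: `t ∈ S` is in the first smallest cell and every rival of height `≥` is not -/
  dom : Fin F → V → Λ
  /-- `ndom k u = ¬ dom k u` -/
  ndom : Fin F → V → Λ
  /-- `go k = ∃ t ∈ S, dom k t`: the OR-step of stage `k` is taken -/
  go : Fin F → Λ
  /-- `ng k = ¬ go k` -/
  ng : Fin F → Λ
  /-- `tieD k u v = eqS k u v ∧ ¬dom k u ∧ dom k v` -/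
  tieD : Fin F → V → V → Λ
  /-- `ltI k u v`: order of the individualised colouring -/
  ltI : Fin F → V → V → Λ
  /-- `bothD k u v = dom k u ∧ dom k v` -/
  bothD : Fin F → V → V → Λ
  /-- `noneD k u v = ¬dom k u ∧ ¬dom k v` -/
  noneD : Fin F → V → V → Λ
  /-- `deqv k u v = (dom k u ↔ dom k v)` -/
  deqv : Fin F → V → V → Λ
  /-- `eqI k u v`: kernel of the individualised colouring -/
  eqI : Fin F → V → V → Λ
  /-- stage `k`: the refinement module on the individualised colouring -/
  RI : Fin F → P.RefineIter V N T
  /-- stage `k`: the atom module under the refined kernel -/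
  AI : Fin F → AtomIter P V N T J
  /-- multiplexer, membership: `go ∧ new` -/
  m1M : Fin F → V → Λ
  /-- multiplexer, membership: `¬go ∧ old` -/
  m2M : Fin F → V → Λ
  /-- multiplexer, membership: output -/
  mxM : Fin F → V → Λ
  /-- multiplexer, order: `go ∧ new` -/
  m1L : Fin F → V → V → Λ
  /-- multiplexer, order: `¬go ∧ old` -/
  m2L : Fin F → V → V → Λ
  /-- multiplexer, order: output -/
  mxL : Fin F → V → V → Λ
  /-- multiplexer, kernel: `go ∧ new` -/
  m1E : Fin F → V → V → Λ
  /-- multiplexer, kernel: `¬go ∧ old` -/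
  m2E : Fin F → V → V → Λ
  /-- multiplexer, kernel: output -/
  mxE : Fin F → V → V → Λ
  -- the first smallest cell gadget reads the state
  M_mem : ∀ k, (M k).mem = memS k.castSucc
  M_eq : ∀ k, (M k).eq = eqS k.castSucc
  M_lt : ∀ k, (M k).lt = ltS k.castSucc
  -- choice gates
  kind_insel : ∀ k t, P.kind (insel k t) = Kind.and
  srcs_insel : ∀ k t, P.srcs (insel k t) = {memS k.castSucc t, Sum.inr ((M k).sel t)}
  kind_nins : ∀ k t, P.kind (nins k t) = Kind.nor
  srcs_nins : ∀ k t, P.srcs (nins k t) = {Sum.inr (insel k t)}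
  kind_dom : ∀ k t, P.kind (dom k t) = if t ∈ S then Kind.and else Kind.or
  srcs_dom : ∀ k t, P.srcs (dom k t) = if t ∈ S then
    insert (Sum.inr (insel k t))
      ((S.filter fun t' => t' ≠ t ∧ hgt t ≤ hgt t').image fun t' => Sum.inr (nins k t'))
    else ∅
  kind_ndom : ∀ k u, P.kind (ndom k u) = Kind.nor
  srcs_ndom : ∀ k u, P.srcs (ndom k u) = {Sum.inr (dom k u)}
  kind_go : ∀ k, P.kind (go k) = Kind.or
  srcs_go : ∀ k, P.srcs (go k) = S.image fun t => Sum.inr (dom k t)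
  kind_ng : ∀ k, P.kind (ng k) = Kind.nor
  srcs_ng : ∀ k, P.srcs (ng k) = {Sum.inr (go k)}
  -- individualised colouring: order and kernel
  kind_tieD : ∀ k u v, P.kind (tieD k u v) = Kind.and
  srcs_tieD : ∀ k u v, P.srcs (tieD k u v) = {eqS k.castSucc u v, Sum.inr (ndom k u), Sum.inr (dom k v)}
  kind_ltI : ∀ k u v, P.kind (ltI k u v) = Kind.or
  srcs_ltI : ∀ k u v, P.srcs (ltI k u v) = {ltS k.castSucc u v, Sum.inr (tieD k u v)}
  kind_bothD : ∀ k u v, P.kind (bothD k u v) = Kind.and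
  srcs_bothD : ∀ k u v, P.srcs (bothD k u v) = {Sum.inr (dom k u), Sum.inr (dom k v)}
  kind_noneD : ∀ k u v, P.kind (noneD k u v) = Kind.nor
  srcs_noneD : ∀ k u v, P.srcs (noneD k u v) = {Sum.inr (dom k u), Sum.inr (dom k v)}
  kind_deqv : ∀ k u v, P.kind (deqv k u v) = Kind.or
  srcs_deqv : ∀ k u v, P.srcs (deqv k u v) = {Sum.inr (bothD k u v), Sum.inr (noneD k u v)}
  kind_eqI : ∀ k u v, P.kind (eqI k u v) = Kind.and
  srcs_eqI : ∀ k u v, P.srcs (eqI k u v) = {eqS k.castSucc u v, Sum.inr (deqv k u v)}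
  -- the refinement module reads the block and the individualised colouring
  RI_mem : ∀ k, (RI k).mem = memS k.castSucc
  RI_adj : ∀ k, (RI k).adj = adj
  RI_lt0 : ∀ k u v, (RI k).lt0 u v = Sum.inr (ltI k u v)
  RI_eq0 : ∀ k u v, (RI k).eq0 u v = Sum.inr (eqI k u v)
  -- the atom module reads the block, the refined kernel and the pointer
  AI_mem0 : ∀ k, (AI k).mem0 = memS k.castSucc
  AI_adj : ∀ k, (AI k).adj = adj
  AI_eq : ∀ k u v, (AI k).eq u v = (RI k).eqW (Fin.last T) u v
  AI_ptr : ∀ k, (AI k).ptr = ptr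
  -- multiplexers
  kind_m1M : ∀ k u, P.kind (m1M k u) = Kind.and
  srcs_m1M : ∀ k u, P.srcs (m1M k u) = {Sum.inr (go k), (AI k).memW (Fin.last J) u}
  kind_m2M : ∀ k u, P.kind (m2M k u) = Kind.and
  srcs_m2M : ∀ k u, P.srcs (m2M k u) = {Sum.inr (ng k), memS k.castSucc u}
  kind_mxM : ∀ k u, P.kind (mxM k u) = Kind.or
  srcs_mxM : ∀ k u, P.srcs (mxM k u) = {Sum.inr (m1M k u), Sum.inr (m2M k u)}
  kind_m1L : ∀ k u v, P.kind (m1L k u v) = Kind.and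
  srcs_m1L : ∀ k u v, P.srcs (m1L k u v) = {Sum.inr (go k), (RI k).ltW (Fin.last T) u v}
  kind_m2L : ∀ k u v, P.kind (m2L k u v) = Kind.and
  srcs_m2L : ∀ k u v, P.srcs (m2L k u v) = {Sum.inr (ng k), ltS k.castSucc u v}
  kind_mxL : ∀ k u v, P.kind (mxL k u v) = Kind.or
  srcs_mxL : ∀ k u v, P.srcs (mxL k u v) = {Sum.inr (m1L k u v), Sum.inr (m2L k u v)}
  kind_m1E : ∀ k u v, P.kind (m1E k u v) = Kind.and
  srcs_m1E : ∀ k u v, P.srcs (m1E k u v) = {Sum.inr (go k), (RI k).eqW (Fin.last T) u v}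
  kind_m2E : ∀ k u v, P.kind (m2E k u v) = Kind.and
  srcs_m2E : ∀ k u v, P.srcs (m2E k u v) = {Sum.inr (ng k), eqS k.castSucc u v}
  kind_mxE : ∀ k u v, P.kind (mxE k u v) = Kind.or
  srcs_mxE : ∀ k u v, P.srcs (mxE k u v) = {Sum.inr (m1E k u v), Sum.inr (m2E k u v)}
  -- the state of the next stage is the multiplexer output
  memS_succ : ∀ (k : Fin F) u, memS k.succ u = Sum.inr (mxM k u)
  ltS_succ : ∀ (k : Fin F) u v, ltS k.succ u v = Sum.inr (mxL k u v)
  eqS_succ : ∀ (k : Fin F) u v, eqS k.succ u v = Sum.inr (mxE k u v)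

namespace ReplayIter

variable {P V N T J F} (RP : ReplayIter P V N T J F) (x : ι → Bool)

/-- **The state read at stage `k`**: the membership wires read the block `A`, and ON `A` the order and kernel
wires read the colouring `col`. [folklore] -/
structure StateReads (k : Fin (F + 1)) (A : Finset V) (col : V → ℕ) : Prop where
  /-- membership -/
  mem_iff : ∀ u, wval x (P.sem x) (RP.memS k u) = true ↔ u ∈ A
  /-- order on the block -/
  lt_iff : ∀ a ∈ A, ∀ b ∈ A, wval x (P.sem x) (RP.ltS k a b) = true ↔ col a < col b
  /-- kernel on the block -/
  eq_iff : ∀ a ∈ A, ∀ b ∈ A, wval x (P.sem x) (RP.eqS k a b) = true ↔ col a = col b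

end ReplayIter

/-! ### The mathematical step the module performs (the body of `BranchSum.replay`) -/

section Step

variable {V : Type*} [DecidableEq V] (G : SimpleGraph V) [DecidableRel G.Adj] (S : Finset V) (hgt : V → ℕ) (ptr : V)

/-- The DOMINATING label points of a state: label points of the first smallest cell whose height beats every
other label point of that cell (the filter in the body of `BranchSum.replay`). [folklore] -/
noncomputable def domSet (St : Finset V × (V → ℕ)) : Finset V :=
  (BranchSum.smallestCell St.1 St.2 ∩ S).filter fun y =>
    ∀ y' ∈ BranchSum.smallestCell St.1 St.2 ∩ S, y' ≠ y → hgt y' < hgt y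

/-- The STEP CONDITION of `BranchSum.replay`: at least two vertices and exactly one dominating point. [folklore] -/
def StepCond (St : Finset V × (V → ℕ)) : Prop := 2 ≤ St.1.card ∧ (domSet S hgt St).card = 1

open scoped Classical in
/-- One step of `BranchSum.replay`: the OR-step at the dominating point if the condition holds, else stay. [folklore] -/
noncomputable def stepSt (St : Finset V × (V → ℕ)) : Finset V × (V → ℕ) :=
  if h : StepCond S hgt St then BranchSum.orStep G ptr St (Finset.card_eq_one.1 h.2).choose else St

/-- EQUITABLE INSIDE the block (the hypothesis shape of `BranchSum.two_le_card_cellOf`). [folklore] -/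
def EqIn (A : Finset V) (c : V → ℕ) : Prop :=
  ∀ u ∈ A, ∀ u' ∈ A, c u = c u' → ∀ w ∈ A,
    ((BranchSum.cellOf A c w).filter fun y => G.Adj u y).card =
      ((BranchSum.cellOf A c w).filter fun y => G.Adj u' y).card

/-- CONNECTED switching graph of the block (cut form). [folklore] -/
def ConnIn (A : Finset V) (c : V → ℕ) : Prop :=
  ∀ S' ⊆ A, S'.Nonempty → S' ≠ A → ∃ a ∈ S', ∃ b ∈ A \ S', (BranchSum.swGraph G A c).Adj a b

end Step

end Summit.PneNP.PneNP.Theorems
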